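import Literature.AlgebraicGeometry.Deformation.SmoothSchemeLiftObstructionCriterionGlueLineBundleCocycle
import Literature.AlgebraicGeometry.Deformation.SmoothSchemeLiftObstructionCriterionGlueReduction
import Literature.AlgebraicGeometry.Modules.PullbackFrame
import Literature.AlgebraicGeometry.Modules.AdaptedFrame
import Literature.AlgebraicGeometry.Modules.IsoOfFrames
import HarnessLib

/-!
# Gluing the lifted charts, VI-c: base change of the rank-one module defined by an exact twisted unit cocycle
# (Hartshorne, *Deformation Theory*, Thm. 6.4 (a) / Thm. 10.2 proof; *Algebraic Geometry* II Ex. 5.18 (c))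

Layer `Literature/AlgebraicGeometry/Deformation` (cell `hodgecm-mathlib`, F-11 sub-line `F11SmoothRoadA`, α1 grandchild
`F11LiftWithLineBundle`, stub G2 dictionary D1-B; THEOREMS ONLY — no definition, no instance, no notation, no named fact).
Sequel of `…CriterionGlueLineBundleCocycle` (overlap sections `g_{jl}` of lifted transition units `G j l` on the glued
deformation, characterised by their chart readings) and of `…CriterionGlueReduction` (the change-of-coefficients morphism
`Φ : X'_{R'} ⟶ X'_R` of glued deformations along a `k`-algebra map `σ : R → R'` for COMPATIBLE gluing data `ψ`, `ψ'`, with its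
chart squares `ι' j ≫ Φ = Spec (σ ⊗ 1) ≫ ι j`), whose `variable`s are repeated VERBATIM.

* §1 `opensRange_le_preimage_baseChangeMap` (`ι' j (C' j) ⊆ Φ⁻¹ ι j (C j)`), `iSup_opensRange_eq_top` (the charts cover).
* §2 **`appLE_baseChangeMap_overlapSection`** — the overlap sections are NATURAL: `Φ^♯ g_{jl} = g'_{jl}`, where `g'_{jl}` are the
  overlap sections of `(σ ⊗ 1) ∘ G` on `X'_{R'}` (chart readings are natural: FILE 4a `comp_chartRingHom_baseChange`).
* §3 **`nonempty_pullback_iso_of_overlapSections`** — THE HEAD: if `L` on `X'_R` has frames on the chart images with transition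
  functions `g_{jl}` and `L'` on `X'_{R'}` has frames on the chart images with transition functions `g'_{jl}` (both shapes are the
  output of `…CriterionGlueLineBundle.exists_rankOne_frames_of_twistedCocycle`; `L'` may be ANY module so framed), then
  `Φ^* L ≅ L'` (★ `Modules/PullbackFrame.transition_pullbackFrame`: pulled-back frames have pulled-back transition matrices;
  ★ `Modules/IsoOfFrames.isoOfFrames`: equal transition matrices on a common cover ⇒ isomorphic).

Consumer (G2 assembler): `σ = (A → A⧸J)`, `ψ = ψ₂` the moved data over `A`, `ψ' = φ` the data of `A₀` — «the lift `L₂` on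
`X₂ = Glue_A(ψ₂)` restricts along the reduction to the bundle with transition functions `G mod J`», to be compared with `L₀` through
the dictionary `A₀.X ≅ Glue_{A⧸J}(φ)` by the same recognition principle.  HC_CM is proved only modulo the 7 printed citations until
rung 0 closes — nothing here bears on a summit statement.

## References
* [Hartshorne1977] R. Hartshorne, *Algebraic Geometry*, GTM 52 (1977): II.5 p. 110 (`f^*` of a locally free sheaf), II Ex. 5.18
  (b), (c) (locally free sheaves and their isomorphisms from transition data).
* [Hartshorne2010] R. Hartshorne, *Deformation Theory*, GTM 257, Springer (2010): Thm. 6.4 (a) and its proof (pp. 50–51); Thm. 10.2 (a)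
  proof (p. 81).
* [StacksProject] The Stacks Project, Tag 01JA (glueing schemes; functoriality), Tag 01LH.
-/

noncomputable section

-- `TopCat.Presheaf`/`TopCat.Sheaf` are not reducible (as in Mathlib's `AlgebraicGeometry/Modules`).
set_option backward.isDefEq.respectTransparency false

open CategoryTheory AlgebraicGeometry Opposite TopologicalSpace Limits
open scoped TensorProduct

universe u

namespace Literature.AlgebraicGeometry.Deformation

section D1B

open Literature.AlgebraicGeometry.Motives Literature.AlgebraicGeometry.Morphisms Literature.AlgebraicGeometry.Modules

variable {k : Type u} [Field k] {X : Over (Spec (CommRingCat.of k))}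
  [instΓ : ∀ W : X.left.Opens, Algebra k Γ(X.left, W)]
  (halg : ∀ (W : X.left.Opens) (s : k), algebraMap k Γ(X.left, W) s = (constToPresheaf X).app (op W) s)
  {R R' : Type u} [CommRing R] [Algebra k R] [CommRing R'] [Algebra k R'] (σ : R →ₐ[k] R')
  {ι : Type u} (U : ι → X.left.affineOpens) (b : (j l : ι) → Γ(X.left, (U j).1))
  (hb : ∀ j l, (U j).1 ⊓ (U l).1 = X.left.basicOpen (b j l))
  (ψ : (j l : ι) → R ⊗[k] Γ(X.left, (U j).1 ⊓ (U l).1) ≃ₐ[R] R ⊗[k] Γ(X.left, (U j).1 ⊓ (U l).1))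
  (ψ' : (j l : ι) → R' ⊗[k] Γ(X.left, (U j).1 ⊓ (U l).1) ≃ₐ[R'] R' ⊗[k] Γ(X.left, (U j).1 ⊓ (U l).1))
  (𝔫 : Ideal R) (h𝔫 : IsNilpotent 𝔫) (𝔫' : Ideal R') (h𝔫' : IsNilpotent 𝔫')
  (hψ : ∀ j l x, ψ j l x - x ∈ 𝔫 • (⊤ : Submodule R (R ⊗[k] Γ(X.left, (U j).1 ⊓ (U l).1))))
  (hψ' : ∀ j l x, ψ' j l x - x ∈ 𝔫' • (⊤ : Submodule R' (R' ⊗[k] Γ(X.left, (U j).1 ⊓ (U l).1))))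
  (hcoc : ∀ (j l m : ι)
    (Φjl : R ⊗[k] Γ(X.left, (U j).1 ⊓ (U l).1) →ₐ[R] R ⊗[k] Γ(X.left, (U j).1 ⊓ (U l).1 ⊓ (U m).1))
    (_ : ∀ a s, Φjl (a ⊗ₜ s) = a ⊗ₜ X.left.presheaf.map (homOfLE inf_le_left).op s)
    (Φlm : R ⊗[k] Γ(X.left, (U l).1 ⊓ (U m).1) →ₐ[R] R ⊗[k] Γ(X.left, (U j).1 ⊓ (U l).1 ⊓ (U m).1))
    (_ : ∀ a s, Φlm (a ⊗ₜ s) = a ⊗ₜ X.left.presheaf.map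
      (homOfLE (le_inf (inf_le_left.trans inf_le_right) inf_le_right)).op s)
    (Φjm : R ⊗[k] Γ(X.left, (U j).1 ⊓ (U m).1) →ₐ[R] R ⊗[k] Γ(X.left, (U j).1 ⊓ (U l).1 ⊓ (U m).1))
    (_ : ∀ a s, Φjm (a ⊗ₜ s) = a ⊗ₜ X.left.presheaf.map
      (homOfLE (le_inf (inf_le_left.trans inf_le_left) inf_le_right)).op s)
    (ρjl ρlm ρjm : R ⊗[k] Γ(X.left, (U j).1 ⊓ (U l).1 ⊓ (U m).1) ≃ₐ[R]
      R ⊗[k] Γ(X.left, (U j).1 ⊓ (U l).1 ⊓ (U m).1)),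
    (∀ x, ρjl (Φjl x) = Φjl (ψ j l x)) → (∀ x, ρlm (Φlm x) = Φlm (ψ l m x)) →
    (∀ x, ρjm (Φjm x) = Φjm (ψ j m x)) → ρlm * ρjl = ρjm)
  (hcoc' : ∀ (j l m : ι)
    (Φjl : R' ⊗[k] Γ(X.left, (U j).1 ⊓ (U l).1) →ₐ[R'] R' ⊗[k] Γ(X.left, (U j).1 ⊓ (U l).1 ⊓ (U m).1))
    (_ : ∀ a s, Φjl (a ⊗ₜ s) = a ⊗ₜ X.left.presheaf.map (homOfLE inf_le_left).op s)
    (Φlm : R' ⊗[k] Γ(X.left, (U l).1 ⊓ (U m).1) →ₐ[R'] R' ⊗[k] Γ(X.left, (U j).1 ⊓ (U l).1 ⊓ (U m).1))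
    (_ : ∀ a s, Φlm (a ⊗ₜ s) = a ⊗ₜ X.left.presheaf.map
      (homOfLE (le_inf (inf_le_left.trans inf_le_right) inf_le_right)).op s)
    (Φjm : R' ⊗[k] Γ(X.left, (U j).1 ⊓ (U m).1) →ₐ[R'] R' ⊗[k] Γ(X.left, (U j).1 ⊓ (U l).1 ⊓ (U m).1))
    (_ : ∀ a s, Φjm (a ⊗ₜ s) = a ⊗ₜ X.left.presheaf.map
      (homOfLE (le_inf (inf_le_left.trans inf_le_left) inf_le_right)).op s)
    (ρjl ρlm ρjm : R' ⊗[k] Γ(X.left, (U j).1 ⊓ (U l).1 ⊓ (U m).1) ≃ₐ[R']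
      R' ⊗[k] Γ(X.left, (U j).1 ⊓ (U l).1 ⊓ (U m).1)),
    (∀ x, ρjl (Φjl x) = Φjl (ψ' j l x)) → (∀ x, ρlm (Φlm x) = Φlm (ψ' l m x)) →
    (∀ x, ρjm (Φjm x) = Φjm (ψ' j m x)) → ρlm * ρjl = ρjm)
  (G : (j l : ι) → R ⊗[k] Γ(X.left, (U j).1 ⊓ (U l).1))

/-! ## §1 The change-of-coefficients morphism and the chart images -/

/-- Under the change-of-coefficients morphism `Φ : X'_{R'} ⟶ X'_R` (restricting to `Spec (σ ⊗ 1)` on the charts), the image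
of chart `j` of `X'_{R'}` maps into the image of chart `j` of `X'_R`. [cite: StacksProject, Tag 01JA] -/
theorem opensRange_le_preimage_baseChangeMap
    (Φ : (deformationGlueDatum halg R' U b hb ψ' 𝔫' h𝔫' hψ' hcoc').glueData.glued ⟶
      (deformationGlueDatum halg R U b hb ψ 𝔫 h𝔫 hψ hcoc).glueData.glued)
    (hΦ : ∀ j, (deformationGlueDatum halg R' U b hb ψ' 𝔫' h𝔫' hψ' hcoc').glueData.ι j ≫ Φ =
      Spec.map (CommRingCat.ofHom (Algebra.TensorProduct.map σ (AlgHom.id k Γ(X.left, (U j).1))).toRingHom) ≫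
        (deformationGlueDatum halg R U b hb ψ 𝔫 h𝔫 hψ hcoc).glueData.ι j) (j : ι) :
    ((deformationGlueDatum halg R' U b hb ψ' 𝔫' h𝔫' hψ' hcoc').glueData.ι j).opensRange ≤
      Φ ⁻¹ᵁ ((deformationGlueDatum halg R U b hb ψ 𝔫 h𝔫 hψ hcoc).glueData.ι j).opensRange := by
  rintro _ ⟨y, rfl⟩
  change Φ ((deformationGlueDatum halg R' U b hb ψ' 𝔫' h𝔫' hψ' hcoc').glueData.ι j y) ∈
    Set.range ((deformationGlueDatum halg R U b hb ψ 𝔫 h𝔫 hψ hcoc).glueData.ι j)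
  rw [← Scheme.Hom.comp_apply, hΦ, Scheme.Hom.comp_apply]
  exact ⟨_, rfl⟩

include hb h𝔫' hψ' in
/-- The charts of `X'_{R'}` cover it: `⨆_j ι' j (C' j) = ⊤`. [cite: StacksProject, Tag 01JA] -/
theorem iSup_opensRange_eq_top :
    ⨆ j, ((deformationGlueDatum halg R' U b hb ψ' 𝔫' h𝔫' hψ' hcoc').glueData.ι j).opensRange = ⊤ :=
  top_le_iff.mp fun x _ => by
    obtain ⟨j, y, hy⟩ := (deformationGlueDatum halg R' U b hb ψ' 𝔫' h𝔫' hψ' hcoc').glueData.ι_jointly_surjective x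
    exact Opens.mem_iSup.mpr ⟨j, ⟨y, hy⟩⟩

/-! ## §2 The overlap sections pull back to the overlap sections of `σ ∘ G` -/

include hb h𝔫 h𝔫' hψ hψ' in
set_option maxHeartbeats 400000 in -- two glued schemes, one chart-ring naturality square
/-- **The overlap sections are natural in the coefficient ring**: `Φ^♯ g_{jl} = g'_{jl}`, where `g_{jl}` are the overlap
sections of `G` on `X'_R` and `g'_{jl}` those of `(σ ⊗ 1) ∘ G` on `X'_{R'}` (both characterised by their chart-`j`
readings; the chart ring maps are natural, FILE 4a `comp_chartRingHom_baseChange`).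
[cite: Hartshorne2010, Thm. 10.2 (proof), p. 81] [cite: Hartshorne1977, II Ex. 5.18 (b)] -/
theorem appLE_baseChangeMap_overlapSection
    (Φ : (deformationGlueDatum halg R' U b hb ψ' 𝔫' h𝔫' hψ' hcoc').glueData.glued ⟶
      (deformationGlueDatum halg R U b hb ψ 𝔫 h𝔫 hψ hcoc).glueData.glued)
    (hΦ : ∀ j, (deformationGlueDatum halg R' U b hb ψ' 𝔫' h𝔫' hψ' hcoc').glueData.ι j ≫ Φ =
      Spec.map (CommRingCat.ofHom (Algebra.TensorProduct.map σ (AlgHom.id k Γ(X.left, (U j).1))).toRingHom) ≫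
        (deformationGlueDatum halg R U b hb ψ 𝔫 h𝔫 hψ hcoc).glueData.ι j)
    (s : (j l : ι) →
      Γ((deformationGlueDatum halg R U b hb ψ 𝔫 h𝔫 hψ hcoc).glueData.glued,
        ((deformationGlueDatum halg R U b hb ψ 𝔫 h𝔫 hψ hcoc).glueData.ι j).opensRange ⊓
          ((deformationGlueDatum halg R U b hb ψ 𝔫 h𝔫 hψ hcoc).glueData.ι l).opensRange))
    (hs : ∀ j l, ((chartOverlap R U j l).ι ≫ (deformationGlueDatum halg R U b hb ψ 𝔫 h𝔫 hψ hcoc).glueData.ι j).appLE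
        (((deformationGlueDatum halg R U b hb ψ 𝔫 h𝔫 hψ hcoc).glueData.ι j).opensRange ⊓
          ((deformationGlueDatum halg R U b hb ψ 𝔫 h𝔫 hψ hcoc).glueData.ι l).opensRange) ⊤
        (top_le_preimage_opensRange_inf halg R U b hb ψ 𝔫 h𝔫 hψ hcoc j l) (s j l) =
      overlapRingHom halg R U j l (G j l))
    (s' : (j l : ι) →
      Γ((deformationGlueDatum halg R' U b hb ψ' 𝔫' h𝔫' hψ' hcoc').glueData.glued,
        ((deformationGlueDatum halg R' U b hb ψ' 𝔫' h𝔫' hψ' hcoc').glueData.ι j).opensRange ⊓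
          ((deformationGlueDatum halg R' U b hb ψ' 𝔫' h𝔫' hψ' hcoc').glueData.ι l).opensRange))
    (hs' : ∀ j l, ((chartOverlap R' U j l).ι ≫
        (deformationGlueDatum halg R' U b hb ψ' 𝔫' h𝔫' hψ' hcoc').glueData.ι j).appLE
        (((deformationGlueDatum halg R' U b hb ψ' 𝔫' h𝔫' hψ' hcoc').glueData.ι j).opensRange ⊓
          ((deformationGlueDatum halg R' U b hb ψ' 𝔫' h𝔫' hψ' hcoc').glueData.ι l).opensRange) ⊤
        (top_le_preimage_opensRange_inf halg R' U b hb ψ' 𝔫' h𝔫' hψ' hcoc' j l) (s' j l) =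
      overlapRingHom halg R' U j l
        (Algebra.TensorProduct.map σ (AlgHom.id k Γ(X.left, (U j).1 ⊓ (U l).1)) (G j l)))
    (j l : ι) :
    Φ.appLE (((deformationGlueDatum halg R U b hb ψ 𝔫 h𝔫 hψ hcoc).glueData.ι j).opensRange ⊓
          ((deformationGlueDatum halg R U b hb ψ 𝔫 h𝔫 hψ hcoc).glueData.ι l).opensRange)
        (((deformationGlueDatum halg R' U b hb ψ' 𝔫' h𝔫' hψ' hcoc').glueData.ι j).opensRange ⊓
          ((deformationGlueDatum halg R' U b hb ψ' 𝔫' h𝔫' hψ' hcoc').glueData.ι l).opensRange)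
        (inf_le_inf (opensRange_le_preimage_baseChangeMap halg σ U b hb ψ ψ' 𝔫 h𝔫 𝔫' h𝔫' hψ hψ' hcoc hcoc' Φ hΦ j)
          (opensRange_le_preimage_baseChangeMap halg σ U b hb ψ ψ' 𝔫 h𝔫 𝔫' h𝔫' hψ hψ' hcoc hcoc' Φ hΦ l))
        (s j l) = s' j l := by
  -- the chart map `a : W' j l → W j l` over `φ j = Spec (σ ⊗ 1)`
  obtain ⟨a, ha⟩ : ∃ a : (chartOverlap R' U j l : (Spec (CommRingCat.of (R' ⊗[k] Γ(X.left, (U j).1)))).Opens).toScheme ⟶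
      (chartOverlap R U j l : (Spec (CommRingCat.of (R ⊗[k] Γ(X.left, (U j).1)))).Opens).toScheme,
      a ≫ (chartOverlap R U j l).ι = (chartOverlap R' U j l).ι ≫
        Spec.map (CommRingCat.ofHom (Algebra.TensorProduct.map σ (AlgHom.id k Γ(X.left, (U j).1))).toRingHom) :=
    ⟨(Scheme.isoOfEq _ (chartOverlap_baseChange σ U j l)).hom ≫
      (Spec.map (CommRingCat.ofHom (Algebra.TensorProduct.map σ (AlgHom.id k Γ(X.left, (U j).1))).toRingHom) ∣_
        chartOverlap R U j l), by rw [Category.assoc, morphismRestrict_ι, Scheme.isoOfEq_hom_ι_assoc]⟩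
  -- naturality of the chart ring maps (FILE 4a)
  have hnat := comp_chartRingHom_baseChange σ (U j).2 (chartProj R U j) rfl (chartProj R' U j) rfl
    (map_toRingHom_tmul σ (U j).1) a ha (overlapRingHom_tmul_one halg R U j l) (overlapRingHom_one_tmul halg R U j l)
    (overlapRingHom_tmul_one halg R' U j l) (overlapRingHom_one_tmul halg R' U j l)
    (map_toRingHom_tmul σ ((U j).1 ⊓ (U l).1))
  -- compare the chart-`j` readings on `X'_{R'}`
  apply overlapSection_unique halg R' U b hb ψ' 𝔫' h𝔫' hψ' hcoc'
  rw [hs' j l, ← CommRingCat.comp_apply, Scheme.Hom.appLE_comp_appLE]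
  have e : ((chartOverlap R' U j l).ι ≫ (deformationGlueDatum halg R' U b hb ψ' 𝔫' h𝔫' hψ' hcoc').glueData.ι j) ≫ Φ =
      a ≫ ((chartOverlap R U j l).ι ≫ (deformationGlueDatum halg R U b hb ψ 𝔫 h𝔫 hψ hcoc).glueData.ι j) := by
    rw [Category.assoc, hΦ, ← Category.assoc, ← ha, Category.assoc]
  rw [appLE_eq_of_eq e]
  have e2 : (a ≫ ((chartOverlap R U j l).ι ≫ (deformationGlueDatum halg R U b hb ψ 𝔫 h𝔫 hψ hcoc).glueData.ι j)).appLE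
      (((deformationGlueDatum halg R U b hb ψ 𝔫 h𝔫 hψ hcoc).glueData.ι j).opensRange ⊓
        ((deformationGlueDatum halg R U b hb ψ 𝔫 h𝔫 hψ hcoc).glueData.ι l).opensRange) ⊤
      (by rw [Scheme.Hom.comp_preimage, top_le_iff.mp (top_le_preimage_opensRange_inf halg R U b hb ψ 𝔫 h𝔫 hψ hcoc j l)]
          exact le_top) =
      ((chartOverlap R U j l).ι ≫ (deformationGlueDatum halg R U b hb ψ 𝔫 h𝔫 hψ hcoc).glueData.ι j).appLE
        (((deformationGlueDatum halg R U b hb ψ 𝔫 h𝔫 hψ hcoc).glueData.ι j).opensRange ⊓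
          ((deformationGlueDatum halg R U b hb ψ 𝔫 h𝔫 hψ hcoc).glueData.ι l).opensRange) ⊤
        (top_le_preimage_opensRange_inf halg R U b hb ψ 𝔫 h𝔫 hψ hcoc j l) ≫ a.appTop := by
    rw [Scheme.Hom.appTop, Scheme.Hom.app_eq_appLE, Scheme.Hom.appLE_comp_appLE]
    rfl
  erw [e2]
  rw [CommRingCat.comp_apply, hs j l]
  exact RingHom.congr_fun hnat (G j l)

/-! ## §3 The pull-back of the glued rank-one module is the glued rank-one module of `σ ∘ G` -/

include hb h𝔫 h𝔫' hψ hψ' in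
/-- **BASE CHANGE OF THE GLUED RANK-ONE MODULE.**  Let `L` on `X'_R` carry frames `e_j` on the chart images with transition
functions the overlap sections `g_{jl}` of `G`, and `L'` on `X'_{R'}` frames `e'_j` with transition functions the overlap
sections `g'_{jl}` of `(σ ⊗ 1) ∘ G` (e.g. both from `exists_rankOne_frames_of_twistedCocycle`; or `L'` ANY module so framed).
Then `Φ^* L ≅ L'` for the change-of-coefficients morphism `Φ : X'_{R'} ⟶ X'_R`: the pulled-back frames `Φ^* e_j` have
transition functions `Φ^♯ g_{jl} = g'_{jl}` (★ `transition_pullbackFrame`, §2), and modules with frames on a common cover and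
equal transition matrices are isomorphic (★ `isoOfFrames`, Hartshorne II Ex. 5.18 (c)).  For the reduction
`σ : A → A⧸J` of a small extension this is «`L₂` restricts to the bundle with transition functions `G mod J`».
[cite: Hartshorne1977, II Ex. 5.18 (c)] [cite: Hartshorne2010, Thm. 6.4 (a) (proof, pp. 50–51)] [cite: StacksProject, Tag 01JA] -/
theorem nonempty_pullback_iso_of_overlapSections
    (Φ : (deformationGlueDatum halg R' U b hb ψ' 𝔫' h𝔫' hψ' hcoc').glueData.glued ⟶
      (deformationGlueDatum halg R U b hb ψ 𝔫 h𝔫 hψ hcoc).glueData.glued)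
    (hΦ : ∀ j, (deformationGlueDatum halg R' U b hb ψ' 𝔫' h𝔫' hψ' hcoc').glueData.ι j ≫ Φ =
      Spec.map (CommRingCat.ofHom (Algebra.TensorProduct.map σ (AlgHom.id k Γ(X.left, (U j).1))).toRingHom) ≫
        (deformationGlueDatum halg R U b hb ψ 𝔫 h𝔫 hψ hcoc).glueData.ι j)
    (s : (j l : ι) →
      Γ((deformationGlueDatum halg R U b hb ψ 𝔫 h𝔫 hψ hcoc).glueData.glued,
        ((deformationGlueDatum halg R U b hb ψ 𝔫 h𝔫 hψ hcoc).glueData.ι j).opensRange ⊓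
          ((deformationGlueDatum halg R U b hb ψ 𝔫 h𝔫 hψ hcoc).glueData.ι l).opensRange))
    (hs : ∀ j l, ((chartOverlap R U j l).ι ≫ (deformationGlueDatum halg R U b hb ψ 𝔫 h𝔫 hψ hcoc).glueData.ι j).appLE
        (((deformationGlueDatum halg R U b hb ψ 𝔫 h𝔫 hψ hcoc).glueData.ι j).opensRange ⊓
          ((deformationGlueDatum halg R U b hb ψ 𝔫 h𝔫 hψ hcoc).glueData.ι l).opensRange) ⊤
        (top_le_preimage_opensRange_inf halg R U b hb ψ 𝔫 h𝔫 hψ hcoc j l) (s j l) =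
      overlapRingHom halg R U j l (G j l))
    (s' : (j l : ι) →
      Γ((deformationGlueDatum halg R' U b hb ψ' 𝔫' h𝔫' hψ' hcoc').glueData.glued,
        ((deformationGlueDatum halg R' U b hb ψ' 𝔫' h𝔫' hψ' hcoc').glueData.ι j).opensRange ⊓
          ((deformationGlueDatum halg R' U b hb ψ' 𝔫' h𝔫' hψ' hcoc').glueData.ι l).opensRange))
    (hs' : ∀ j l, ((chartOverlap R' U j l).ι ≫
        (deformationGlueDatum halg R' U b hb ψ' 𝔫' h𝔫' hψ' hcoc').glueData.ι j).appLE
        (((deformationGlueDatum halg R' U b hb ψ' 𝔫' h𝔫' hψ' hcoc').glueData.ι j).opensRange ⊓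
          ((deformationGlueDatum halg R' U b hb ψ' 𝔫' h𝔫' hψ' hcoc').glueData.ι l).opensRange) ⊤
        (top_le_preimage_opensRange_inf halg R' U b hb ψ' 𝔫' h𝔫' hψ' hcoc' j l) (s' j l) =
      overlapRingHom halg R' U j l
        (Algebra.TensorProduct.map σ (AlgHom.id k Γ(X.left, (U j).1 ⊓ (U l).1)) (G j l)))
    (L : (deformationGlueDatum halg R U b hb ψ 𝔫 h𝔫 hψ hcoc).glueData.glued.Modules)
    (e : ∀ j, SheafOfModules.free (PUnit : Type u) ≅
      L.over ((deformationGlueDatum halg R U b hb ψ 𝔫 h𝔫 hψ hcoc).glueData.ι j).opensRange)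
    (he : ∀ (j l : ι) (V : (deformationGlueDatum halg R U b hb ψ 𝔫 h𝔫 hψ hcoc).glueData.glued.Opens)
      (hj : V ≤ ((deformationGlueDatum halg R U b hb ψ 𝔫 h𝔫 hψ hcoc).glueData.ι j).opensRange)
      (hl : V ≤ ((deformationGlueDatum halg R U b hb ψ 𝔫 h𝔫 hψ hcoc).glueData.ι l).opensRange),
      transition (e j) (e l) (homOfLE hj) (homOfLE hl) =
        Matrix.of fun _ _ => secRes (deformationGlueDatum halg R U b hb ψ 𝔫 h𝔫 hψ hcoc).glueData.glued
          (le_inf hj hl) (s j l))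
    (L' : (deformationGlueDatum halg R' U b hb ψ' 𝔫' h𝔫' hψ' hcoc').glueData.glued.Modules)
    (e' : ∀ j, SheafOfModules.free (PUnit : Type u) ≅
      L'.over ((deformationGlueDatum halg R' U b hb ψ' 𝔫' h𝔫' hψ' hcoc').glueData.ι j).opensRange)
    (he' : ∀ (j l : ι) (V : (deformationGlueDatum halg R' U b hb ψ' 𝔫' h𝔫' hψ' hcoc').glueData.glued.Opens)
      (hj : V ≤ ((deformationGlueDatum halg R' U b hb ψ' 𝔫' h𝔫' hψ' hcoc').glueData.ι j).opensRange)
      (hl : V ≤ ((deformationGlueDatum halg R' U b hb ψ' 𝔫' h𝔫' hψ' hcoc').glueData.ι l).opensRange),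
      transition (e' j) (e' l) (homOfLE hj) (homOfLE hl) =
        Matrix.of fun _ _ => secRes (deformationGlueDatum halg R' U b hb ψ' 𝔫' h𝔫' hψ' hcoc').glueData.glued
          (le_inf hj hl) (s' j l)) :
    Nonempty ((Scheme.Modules.pullback Φ).obj L ≅ L') := by
  have hV := opensRange_le_preimage_baseChangeMap halg σ U b hb ψ ψ' 𝔫 h𝔫 𝔫' h𝔫' hψ hψ' hcoc hcoc' Φ hΦ
  -- frames of `Φ^* L` on the chart images of `X'_{R'}`: the pulled-back frames, restricted
  refine ⟨isoOfFrames (fun j => ((deformationGlueDatum halg R' U b hb ψ' 𝔫' h𝔫' hψ' hcoc').glueData.ι j).opensRange)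
    (fun j => SheafOfModules.restrictTrivialisation
      (R := (deformationGlueDatum halg R' U b hb ψ' 𝔫' h𝔫' hψ' hcoc').glueData.glued.ringCatSheaf)
      (homOfLE (hV j)) (pullbackFrame Φ (e j)))
    e' (fun j l => ?_) (iSup_opensRange_eq_top halg U b hb ψ' 𝔫' h𝔫' hψ' hcoc')⟩
  beta_reduce
  -- equal transition matrices on `ι' j (C' j) ∩ ι' l (C' l)`
  have k₁ : Opens.infLELeft
      ((deformationGlueDatum halg R' U b hb ψ' 𝔫' h𝔫' hψ' hcoc').glueData.ι j).opensRange
      ((deformationGlueDatum halg R' U b hb ψ' 𝔫' h𝔫' hψ' hcoc').glueData.ι l).opensRange = homOfLE inf_le_left :=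
    Subsingleton.elim _ _
  have k₂ : Opens.infLERight
      ((deformationGlueDatum halg R' U b hb ψ' 𝔫' h𝔫' hψ' hcoc').glueData.ι j).opensRange
      ((deformationGlueDatum halg R' U b hb ψ' 𝔫' h𝔫' hψ' hcoc').glueData.ι l).opensRange = homOfLE inf_le_right :=
    Subsingleton.elim _ _
  rw [k₁, k₂, he' j l _ inf_le_left inf_le_right, transition_restrictTrivialisation,
    transition_pullbackFrame Φ (e j) (e l) (inf_le_inf (hV j) (hV l)) (homOfLE inf_le_left ≫ homOfLE (hV j))
      (homOfLE inf_le_right ≫ homOfLE (hV l)),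
    he j l _ inf_le_left inf_le_right]
  ext ⟨⟩ ⟨⟩
  rw [Matrix.map_apply, Matrix.of_apply, Matrix.of_apply, secRes_self, secRes_self]
  exact appLE_baseChangeMap_overlapSection halg σ U b hb ψ ψ' 𝔫 h𝔫 𝔫' h𝔫' hψ hψ' hcoc hcoc' G Φ hΦ s hs s' hs' j l

end D1B

end Literature.AlgebraicGeometry.Deformation

end
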